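import Mathlib.Analysis.SpecialFunctions.Pow.Real
import Mathlib.Analysis.SpecialFunctions.Sqrt
import Mathlib.Analysis.Real.Pi.Bounds
import Mathlib.Algebra.Order.BigOperators.Group.Finset

/-!
# `PolycrystalWulffBound`: the arithmetic of the grain-count dichotomy

Route `StickyWulffConstant` of the venture `Summits/Ventures/Crystal3D`, crux `PolycrystalWulffBound`
(item `stmt-Ventures-19482`), second prover lane («grain-count dichotomy + quantitative Wulff
stability», cf-p1 g16).  After perimeter locality (the polytope facet calculus / `stub_density`) has
turned the crux's energy into facet sums, the two CORNER regimes of the dichotomy close by pure real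
arithmetic on a handful of aggregate quantities; this file proves that arithmetic once and for all,
with Mathlib-only imports (no route file in the import cone):

* `sum_rpow_two_thirds_ge` — the CONCAVITY GAIN: if every grain volume `v i ≤ α·V` (`V = Σ v i`),
  then `Σ (v i)^{2/3} ≥ α^{-1/3} · V^{2/3}` (many small grains have much more isoperimetric surface);
* `cbrt_two_bounds`, `cbrt_ten_thirds_lower`, `sqrt_three_lower`, `isoConst_lower` — decimal brackets
  for `2^{1/3}`, `(10/3)^{1/3}`, `√3` and for any `c` with `c³ ≥ 36π` (the isoperimetric constant
  `3|B₁|^{1/3} = (36π)^{1/3} = 4.8360`);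
* `wulffConstant_eq'` — `6·2^{1/3}·(√2 V)^{2/3} = 6·(2^{1/3})²·V^{2/3}` (`= 3·32^{1/3} V^{2/3} = 9.5244 V^{2/3}`);
* `fine_pincer_arith` — FINE TWIN-FREE corner (`rung_fineTwinFree` of line PolyDensity): free area
  `F ≥ c V^{2/3}`, grain boundary areas `P i ≥ c (v i)^{2/3}` with `Σ P i ≤ F + 2 S` (`S` = charged wall
  area), all grains `≤ 3/10` of the volume ⟹ `6·2^{1/3}(√2 V)^{2/3} ≤ √3 F + S`
  (threshold `α ≤ 0.3117`; at `α = 3/10` the margin is `9.570 ≥ 9.524`);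
* `wallRich_arith` — WALL-RICH corner (`rung_wallRich`): `F ≥ c V^{2/3}` and wall energy
  `Wl ≥ (√2 V)^{2/3}` ⟹ `6·2^{1/3}(√2 V)^{2/3} ≤ √3 F + Wl` (`√3·4.836 = 8.376 ≥ 8.264`).

WHAT THIS IS NOT: any statement about sets or perimeters — the geometric inputs (isoperimetric
inequalities, `√3‖ν‖ ≤ Φ(ν)`, facet bookkeeping) are hypotheses here, to be supplied by the polyhedral
rung provers; nothing on the crux beyond its two corners.
-/

noncomputable section

namespace Summit.Ventures.Crystal3D.Theorems

open Real Finset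

/-! ### Decimal brackets -/

/-- `1.2599 ≤ 2^{1/3} ≤ 1.25993` and `(2^{1/3})³ = 2`. -/
theorem cbrt_two_bounds :
    (1.2599 : ℝ) ≤ (2 : ℝ) ^ ((1 : ℝ) / 3) ∧ (2 : ℝ) ^ ((1 : ℝ) / 3) ≤ 1.25993 ∧
      ((2 : ℝ) ^ ((1 : ℝ) / 3)) ^ 3 = 2 := by
  set t : ℝ := (2 : ℝ) ^ ((1 : ℝ) / 3) with ht
  have ht0 : 0 ≤ t := by positivity
  have ht3 : t ^ 3 = 2 := by
    rw [ht, ← Real.rpow_mul_natCast (by norm_num)]; norm_num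
  refine ⟨?_, ?_, ht3⟩
  · by_contra h
    rw [not_le] at h
    have h3 : t ^ 3 < (1.2599 : ℝ) ^ 3 := by gcongr
    rw [ht3] at h3
    norm_num at h3
  · by_contra h
    rw [not_le] at h
    have h3 : (1.25993 : ℝ) ^ 3 < t ^ 3 := by gcongr
    rw [ht3] at h3
    norm_num at h3

/-- `1.4937 ≤ (10/3)^{1/3}`. -/
theorem cbrt_ten_thirds_lower : (1.4937 : ℝ) ≤ (10 / 3 : ℝ) ^ ((1 : ℝ) / 3) := by
  set r : ℝ := (10 / 3 : ℝ) ^ ((1 : ℝ) / 3) with hr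
  have hr0 : 0 ≤ r := by positivity
  have hr3 : r ^ 3 = 10 / 3 := by
    rw [hr, ← Real.rpow_mul_natCast (by norm_num)]; norm_num
  by_contra h
  rw [not_le] at h
  have h3 : r ^ 3 < (1.4937 : ℝ) ^ 3 := by gcongr
  rw [hr3] at h3
  norm_num at h3

/-- `1.732 ≤ √3`. -/
theorem sqrt_three_lower : (1.732 : ℝ) ≤ Real.sqrt 3 := by
  rw [show (1.732 : ℝ) = Real.sqrt (1.732 ^ 2) by rw [Real.sqrt_sq (by norm_num)]]
  exact Real.sqrt_le_sqrt (by norm_num)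

/-- Any constant with `c³ ≥ 36π` (e.g. the isoperimetric constant `(36π)^{1/3} = 3|B₁|^{1/3}`) is
`≥ 4.835`. -/
theorem isoConst_lower {c : ℝ} (hc : 0 < c) (hc3 : 36 * Real.pi ≤ c ^ 3) : (4.835 : ℝ) ≤ c := by
  have hpi : (3.14 : ℝ) < Real.pi := Real.pi_gt_d2
  by_contra h
  rw [not_le] at h
  have h3 : c ^ 3 < (4.835 : ℝ) ^ 3 := by gcongr
  norm_num at h3
  linarith

/-! ### The concavity gain -/

/-- **Concavity gain of the dichotomy.** If `0 ≤ v i ≤ α · V` for every `i ∈ s`, where `V = Σ_{i∈s} v i`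
and `0 < α`, then `α^{-1/3} · V^{2/3} ≤ Σ_{i∈s} (v i)^{2/3}`: splitting a volume into grains each at
most an `α`-fraction multiplies the isoperimetric lower bound by at least `α^{-1/3}`. -/
theorem sum_rpow_two_thirds_ge {ι : Type*} (s : Finset ι) {v : ι → ℝ} {α V : ℝ} (hα : 0 < α)
    (hV : V = ∑ i ∈ s, v i) (hv : ∀ i ∈ s, 0 ≤ v i) (hsmall : ∀ i ∈ s, v i ≤ α * V) :
    α ^ (-(1 : ℝ) / 3) * V ^ ((2 : ℝ) / 3) ≤ ∑ i ∈ s, v i ^ ((2 : ℝ) / 3) := by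
  have hV0 : 0 ≤ V := by rw [hV]; exact sum_nonneg hv
  rcases hV0.eq_or_lt with hV00 | hVpos
  · -- `V = 0`: both sides vanish
    rw [← hV00, Real.zero_rpow (by norm_num), mul_zero]
    exact sum_nonneg fun i hi => Real.rpow_nonneg (hv i hi) _
  have hαV : 0 < α * V := mul_pos hα hVpos
  -- termwise: `v i · (αV)^{-1/3} ≤ (v i)^{2/3}`
  have hterm : ∀ i ∈ s, v i * (α * V) ^ (-(1 : ℝ) / 3) ≤ v i ^ ((2 : ℝ) / 3) := by
    intro i hi
    rcases (hv i hi).eq_or_lt with h0 | hpos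
    · rw [← h0, zero_mul, Real.zero_rpow (by norm_num)]
    · have h1 : (α * V) ^ (-(1 : ℝ) / 3) ≤ v i ^ (-(1 : ℝ) / 3) :=
        Real.rpow_le_rpow_of_nonpos hpos (hsmall i hi) (by norm_num)
      calc v i * (α * V) ^ (-(1 : ℝ) / 3) ≤ v i * v i ^ (-(1 : ℝ) / 3) := by gcongr
        _ = v i ^ ((2 : ℝ) / 3) := by
          conv_lhs => rw [show v i * v i ^ (-(1 : ℝ) / 3) = v i ^ (1 : ℝ) * v i ^ (-(1 : ℝ) / 3) by
            rw [Real.rpow_one]]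
          rw [← Real.rpow_add hpos]; norm_num
  calc α ^ (-(1 : ℝ) / 3) * V ^ ((2 : ℝ) / 3)
      = (∑ i ∈ s, v i) * (α * V) ^ (-(1 : ℝ) / 3) := by
        rw [← hV, Real.mul_rpow hα.le hVpos.le]
        have : V ^ ((2 : ℝ) / 3) = V * V ^ (-(1 : ℝ) / 3) := by
          conv_rhs => rw [show V * V ^ (-(1 : ℝ) / 3) = V ^ (1 : ℝ) * V ^ (-(1 : ℝ) / 3) by
            rw [Real.rpow_one]]
          rw [← Real.rpow_add hVpos]; norm_num
        rw [this]; ring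
    _ = ∑ i ∈ s, v i * (α * V) ^ (-(1 : ℝ) / 3) := by rw [sum_mul]
    _ ≤ ∑ i ∈ s, v i ^ ((2 : ℝ) / 3) := sum_le_sum hterm

/-! ### The crux's constant -/

/-- `6·2^{1/3}·(√2 V)^{2/3} = 6·(2^{1/3})²·V^{2/3}` for `V ≥ 0` (so the crux's left-hand side is
`3·32^{1/3}·V^{2/3} = 9.5244…·V^{2/3}`). -/
theorem wulffConstant_eq' {V : ℝ} (hV : 0 ≤ V) :
    6 * (2 : ℝ) ^ ((1 : ℝ) / 3) * (Real.sqrt 2 * V) ^ ((2 : ℝ) / 3) =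
      6 * ((2 : ℝ) ^ ((1 : ℝ) / 3)) ^ 2 * V ^ ((2 : ℝ) / 3) := by
  have hsqrt : Real.sqrt 2 ^ ((2 : ℝ) / 3) = (2 : ℝ) ^ ((1 : ℝ) / 3) := by
    rw [Real.sqrt_eq_rpow, ← Real.rpow_mul (by norm_num)]; norm_num
  rw [Real.mul_rpow (Real.sqrt_nonneg 2) hV, hsqrt]
  ring

/-! ### The two corners -/

/-- **Fine twin-free corner (arithmetic of `rung_fineTwinFree`).** Let `c > 0` with `c³ ≥ 36π`
(isoperimetric constant), grain volumes `0 ≤ v i ≤ (3/10)·V` with `V = Σ v i`, free area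
`F ≥ c V^{2/3}` (isoperimetry of the union), grain boundary areas `P i ≥ c (v i)^{2/3}` (isoperimetry
of each grain) with `Σ P i ≤ F + 2 S` (each wall facet is counted by two grains, each free facet by
one). Then the polycrystal bound holds for the crude energy `√3 F + S` (free tension `≥ √3`, walls
charged `≥ 1`): `6·2^{1/3}·(√2 V)^{2/3} ≤ √3 F + S`. -/
theorem fine_pincer_arith {ι : Type*} (s : Finset ι) {v P : ι → ℝ} {c V F S : ℝ} (hc : 0 < c)
    (hc3 : 36 * Real.pi ≤ c ^ 3) (hV : V = ∑ i ∈ s, v i) (hv : ∀ i ∈ s, 0 ≤ v i)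
    (hsmall : ∀ i ∈ s, v i ≤ 3 / 10 * V) (hF : c * V ^ ((2 : ℝ) / 3) ≤ F)
    (hP : ∀ i ∈ s, c * v i ^ ((2 : ℝ) / 3) ≤ P i) (hbook : ∑ i ∈ s, P i ≤ F + 2 * S) :
    6 * (2 : ℝ) ^ ((1 : ℝ) / 3) * (Real.sqrt 2 * V) ^ ((2 : ℝ) / 3) ≤ Real.sqrt 3 * F + S := by
  have hV0 : 0 ≤ V := by rw [hV]; exact sum_nonneg hv
  rw [wulffConstant_eq' hV0]
  obtain ⟨-, ht1, -⟩ := cbrt_two_bounds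
  set t : ℝ := (2 : ℝ) ^ ((1 : ℝ) / 3) with ht
  have ht0 : 0 ≤ t := by positivity
  -- the concavity gain with `α = 3/10`: `Σ (v i)^{2/3} ≥ (10/3)^{1/3} V^{2/3}`
  have hgain := sum_rpow_two_thirds_ge s (by norm_num : (0 : ℝ) < 3 / 10) hV hv hsmall
  have hα : (3 / 10 : ℝ) ^ (-(1 : ℝ) / 3) = (10 / 3 : ℝ) ^ ((1 : ℝ) / 3) := by
    rw [show (3 / 10 : ℝ) = (10 / 3)⁻¹ by norm_num, Real.inv_rpow (by norm_num), ← Real.rpow_neg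
      (by norm_num)]
    norm_num
  rw [hα] at hgain
  set r : ℝ := (10 / 3 : ℝ) ^ ((1 : ℝ) / 3) with hr
  have hr1 : (1.4937 : ℝ) ≤ r := cbrt_ten_thirds_lower
  set W : ℝ := V ^ ((2 : ℝ) / 3) with hW
  have hW0 : 0 ≤ W := by positivity
  -- `Σ P i ≥ c Σ (v i)^{2/3} ≥ c r W`
  have hsumP : c * (r * W) ≤ ∑ i ∈ s, P i := by
    calc c * (r * W) ≤ c * ∑ i ∈ s, v i ^ ((2 : ℝ) / 3) := by gcongr
      _ = ∑ i ∈ s, c * v i ^ ((2 : ℝ) / 3) := by rw [mul_sum]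
      _ ≤ ∑ i ∈ s, P i := sum_le_sum hP
  -- so `S ≥ (c r W − F)/2` and `√3 F + S ≥ (√3 − 1/2) F + c r W / 2 ≥ c (√3 − 1/2 + r/2) W`
  have h3 : (1.732 : ℝ) ≤ Real.sqrt 3 := sqrt_three_lower
  have hc1 : (4.835 : ℝ) ≤ c := isoConst_lower hc hc3
  have hS : c * (r * W) ≤ F + 2 * S := hsumP.trans hbook
  -- target: 6 t² W ≤ √3 F + S
  have hFW : c * W ≤ F := hF
  nlinarith [mul_nonneg (sub_nonneg.2 hc1) hW0, mul_nonneg (sub_nonneg.2 hr1) hW0,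
    mul_nonneg (sub_nonneg.2 h3) (le_trans (by positivity) hFW), mul_nonneg ht0 ht0,
    mul_nonneg (mul_nonneg (sub_nonneg.2 hc1) (sub_nonneg.2 hr1)) hW0, sq_nonneg t,
    mul_nonneg (sub_nonneg.2 ht1) ht0]

/-- **Wall-rich corner (arithmetic of `rung_wallRich`).** Let `c > 0` with `c³ ≥ 36π`, `V ≥ 0`, free
area `F ≥ c V^{2/3}` and wall energy `Wl ≥ (√2 V)^{2/3}`. Then `6·2^{1/3}·(√2 V)^{2/3} ≤ √3 F + Wl`
(`√3·(36π)^{1/3} = 8.376 ≥ (6·2^{1/3} − 1)·2^{1/3} = 8.264`). -/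
theorem wallRich_arith {c V F Wl : ℝ} (hc : 0 < c) (hc3 : 36 * Real.pi ≤ c ^ 3) (hV : 0 ≤ V)
    (hF : c * V ^ ((2 : ℝ) / 3) ≤ F) (hWl : (Real.sqrt 2 * V) ^ ((2 : ℝ) / 3) ≤ Wl) :
    6 * (2 : ℝ) ^ ((1 : ℝ) / 3) * (Real.sqrt 2 * V) ^ ((2 : ℝ) / 3) ≤ Real.sqrt 3 * F + Wl := by
  have hsqrt : (Real.sqrt 2 * V) ^ ((2 : ℝ) / 3) = (2 : ℝ) ^ ((1 : ℝ) / 3) * V ^ ((2 : ℝ) / 3) := by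
    have h2 : Real.sqrt 2 ^ ((2 : ℝ) / 3) = (2 : ℝ) ^ ((1 : ℝ) / 3) := by
      rw [Real.sqrt_eq_rpow, ← Real.rpow_mul (by norm_num)]; norm_num
    rw [Real.mul_rpow (Real.sqrt_nonneg 2) hV, h2]
  rw [hsqrt] at hWl ⊢
  obtain ⟨-, ht1, -⟩ := cbrt_two_bounds
  set t : ℝ := (2 : ℝ) ^ ((1 : ℝ) / 3) with ht
  have ht0 : 0 ≤ t := by positivity
  set W : ℝ := V ^ ((2 : ℝ) / 3) with hW
  have hW0 : 0 ≤ W := by positivity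
  have h3 : (1.732 : ℝ) ≤ Real.sqrt 3 := sqrt_three_lower
  have hc1 : (4.835 : ℝ) ≤ c := isoConst_lower hc hc3
  have hFW : c * W ≤ F := hF
  nlinarith [mul_nonneg (sub_nonneg.2 hc1) hW0, mul_nonneg (sub_nonneg.2 h3) (le_trans (by positivity) hFW),
    mul_nonneg ht0 hW0, mul_nonneg (sub_nonneg.2 ht1) hW0, mul_nonneg (mul_nonneg ht0 (sub_nonneg.2 ht1)) hW0]

end Summit.Ventures.Crystal3D.Theorems

end
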